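import Summits.CriticalPhenomena.PercolationContinuityZ3.Theorems.FK.PressureMagnetizationSumRule
import Summits.CriticalPhenomena.PercolationContinuityZ3.Theorems.FK.MagnetizationFieldDerivative
import HarnessLib

/-!
# HERMITE–HADAMARD BOUNDS FOR THE PRESSURE IN THE FIELD: `βh (m*(β) + m(β,h))/2 ≤ ψ(β,h) − ψ(β,0) ≤ βh m(β,h/2)`
# (`h ≥ 0`), from the sum rule `ψ(β,h) − ψ(β,0) = β ∫₀ʰ m(β,t) dt` and the GHS concavity of `m(β,·)` on `[0,∞)`
# (Friedli–Velenik 2017, Prop. 3.29, Thm. 3.43; Griffiths–Hurst–Sherman 1970; Ellis 2006, V.7)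

Claimed R42 (8)(c) in the cell INBOX at 2026-08-29T05:38:20Z by fkp-10a gen 358 (NEW CLAIM #5 of the gen), addressed to coordinator fk-4 gen 292 (seated 04:05Z 2026-08-29 by l.8710; R166 – R169 in force); lineage row FO-10a-g358t (self-suggested), package g358-trapezoid, label TZ-A.
Helper file of the `fk-continuity` build cell (bschramm lane; `--supports stmt-CriticalPhenomena-4575`); builds on
p205010 (kernel theorem, internal audit signed; external expert review pending). No definitions, no named facts, no
sorries; standard axioms. UNCONDITIONAL (nearest-neighbour Ising model on `ℤ^d`, `d ≥ 1`).

The tree's corner bounds (`PressureMagnetizationSumRule`: `β m*(β) h ≤ ψ(β,h) − ψ(β,0) ≤ β m(β,h) h`) use only the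
monotonicity of `m(β,·)`. GHS concavity of `h ↦ m(β,h)` on `[0,∞)` (tree `concaveOn_magnetizationInField`) sharpens both
sides by the Hermite–Hadamard inequalities for the integral of a concave function — the chord from `(0, m*)` to
`(h, m(β,h))` lies below the graph, the tangent line at the midpoint lies above it:

* `chord_le_magnetizationInField` — `((h − t) m*(β) + t m(β,h))/h ≤ m(β,t)` for `0 ≤ t ≤ h`, `0 < h`;
* `magnetizationInField_add_le_two_mul_midpoint` — `m(β,t) + m(β,h−t) ≤ 2 m(β,h/2)` for `0 ≤ t ≤ h`;
* **`trapezoid_le_pressure_sub_pressure_zero`** — `βh (m*(β) + m(β,h))/2 ≤ ψ(β,h) − ψ(β,0)` (`β ≥ 0`, `h ≥ 0`);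
* **`pressure_sub_pressure_zero_le_midpoint`** — `ψ(β,h) − ψ(β,0) ≤ βh m(β,h/2)` (`β ≥ 0`, `h ≥ 0`);
* consequences: `mul_magnetizationInField_half_le` — `h m(β,h)/2 ≤ ∫₀ʰ m ≤ h m(β,h/2)` packaged as
  `(m* + m(h))/2 ≤ (ψ(h) − ψ(0))/(βh) ≤ m(h/2)` (`average_magnetization_mem_Icc`), and the symmetric versions in `|h|`.

## References

* S. Friedli, Y. Velenik, *Statistical Mechanics of Lattice Systems*, CUP (2017), Prop. 3.29, Thm. 3.43, §3.7.
  [FriedliVelenik2017]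
* R. B. Griffiths, C. A. Hurst, S. Sherman, *Concavity of magnetization of an Ising ferromagnet in a positive external
  field*, J. Math. Phys. 11 (1970) 790–795. [GriffithsHurstSherman1970]
* R. S. Ellis, *Entropy, Large Deviations, and Statistical Mechanics*, Springer (2006), §V.7. [Ellis2006]
-/

noncomputable section

namespace Summit.CriticalPhenomena.PercolationContinuityZ3.Theorems.FK

namespace IsingPressure

open MeasureTheory Filter Topology Finset Set intervalIntegral
open Literature.Probability.LatticeModels
open Summit.CriticalPhenomena.PercolationContinuityZ3.Theorems.FK.IsingSusceptibility

variable {d : ℕ}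

/-! ### Chord and midpoint inequalities from GHS concavity -/

/-- **The chord lies below the graph**: for `β ≥ 0`, `0 < h` and `0 ≤ t ≤ h`,
`((h − t) m*(β) + t m(β,h))/h ≤ m(β,t)` (concavity of `m(β,·)` on `[0,∞)`, `m(β,0) = m*(β)`).
[cite: GriffithsHurstSherman1970, Thm. 1; FriedliVelenik2017, §3.7] -/
theorem chord_le_magnetizationInField {β h t : ℝ} (hβ : 0 ≤ β) (hh : 0 < h) (ht0 : 0 ≤ t) (hth : t ≤ h) :
    ((h - t) * spontaneousMagnetization d β + t * magnetizationInField d β h) / h ≤ magnetizationInField d β t := by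
  have hconc := (concaveOn_magnetizationInField (d := d) hβ).2 (mem_Ici.2 (le_refl (0 : ℝ))) (mem_Ici.2 hh.le)
    (show 0 ≤ (h - t) / h from div_nonneg (by linarith) hh.le) (show 0 ≤ t / h from div_nonneg ht0 hh.le)
    (show (h - t) / h + t / h = 1 by field_simp; ring)
  have hpt : ((h - t) / h) • (0 : ℝ) + (t / h) • h = t := by
    simp only [smul_eq_mul, mul_zero, zero_add]; field_simp
  rw [hpt] at hconc
  simp only [smul_eq_mul, magnetizationInField_zero] at hconc
  calc ((h - t) * spontaneousMagnetization d β + t * magnetizationInField d β h) / h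
      = (h - t) / h * spontaneousMagnetization d β + t / h * magnetizationInField d β h := by field_simp
    _ ≤ magnetizationInField d β t := hconc

/-- **The graph lies below twice the midpoint value**: for `β ≥ 0`, `0 ≤ t ≤ h`,
`m(β,t) + m(β,h − t) ≤ 2 m(β,h/2)` (concavity at the midpoint of `t` and `h − t`). [cite: GriffithsHurstSherman1970, Thm. 1; FriedliVelenik2017, §3.7] -/
theorem magnetizationInField_add_le_two_mul_midpoint {β h t : ℝ} (hβ : 0 ≤ β) (ht0 : 0 ≤ t) (hth : t ≤ h) :
    magnetizationInField d β t + magnetizationInField d β (h - t) ≤ 2 * magnetizationInField d β (h / 2) := by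
  have hconc := (concaveOn_magnetizationInField (d := d) hβ).2 (mem_Ici.2 ht0) (mem_Ici.2 (by linarith : 0 ≤ h - t))
    (show (0 : ℝ) ≤ 1 / 2 by norm_num) (show (0 : ℝ) ≤ 1 / 2 by norm_num) (by norm_num)
  have hpt : (1 / 2 : ℝ) • t + (1 / 2 : ℝ) • (h - t) = h / 2 := by simp only [smul_eq_mul]; ring
  rw [hpt] at hconc
  simp only [smul_eq_mul] at hconc
  linarith

/-! ### The Hermite–Hadamard bounds for `ψ(β,h) − ψ(β,0) = β ∫₀ʰ m` -/

/-- **LOWER TRAPEZOID BOUND `βh (m*(β) + m(β,h))/2 ≤ ψ(β,h) − ψ(β,0)`** for `d ≥ 1`, `β ≥ 0`, `h ≥ 0` (integrate the chord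
inequality; sharpens the tree's corner bound `β m*(β) h ≤ ψ(β,h) − ψ(β,0)`). [cite: FriedliVelenik2017, Prop. 3.29 and Thm. 3.43; GriffithsHurstSherman1970] -/
theorem trapezoid_le_pressure_sub_pressure_zero (hd : 1 ≤ d) {β h : ℝ} (hβ : 0 ≤ β) (hh : 0 ≤ h) :
    β * h * (spontaneousMagnetization d β + magnetizationInField d β h) / 2 ≤ pressure d β h - pressure d β 0 := by
  rcases hh.eq_or_lt with rfl | hpos
  · simp
  rw [← integral_mul_magnetizationInField_eq hd hβ le_rfl hh]
  -- integrate `β · chord(t) ≤ β m(β,t)` over `[0,h]`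
  have hchord : ∫ t in (0 : ℝ)..h, β * (((h - t) * spontaneousMagnetization d β + t * magnetizationInField d β h) / h) =
      β * h * (spontaneousMagnetization d β + magnetizationInField d β h) / 2 := by
    have e : (fun t : ℝ => β * (((h - t) * spontaneousMagnetization d β + t * magnetizationInField d β h) / h)) =
        fun t : ℝ => (β * (magnetizationInField d β h - spontaneousMagnetization d β) / h) * t +
          β * spontaneousMagnetization d β := by
      funext t; field_simp; ring
    rw [e, intervalIntegral.integral_add ((continuous_const_mul _).intervalIntegrable _ _)
      (continuous_const.intervalIntegrable _ _), intervalIntegral.integral_const_mul, integral_id,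
      intervalIntegral.integral_const]
    simp only [smul_eq_mul, sub_zero]
    field_simp
    ring
  rw [← hchord]
  refine integral_mono_on hpos.le ?_ ((intervalIntegrable_magnetizationInField (d := d) hβ le_rfl hh).const_mul β) ?_
  · exact (Continuous.intervalIntegrable (by fun_prop) _ _)
  · intro t ht
    exact mul_le_mul_of_nonneg_left (chord_le_magnetizationInField hβ hpos ht.1 ht.2) hβ

/-- **UPPER MIDPOINT BOUND `ψ(β,h) − ψ(β,0) ≤ βh m(β,h/2)`** for `d ≥ 1`, `β ≥ 0`, `h ≥ 0` (the symmetrised integrand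
`(m(t) + m(h−t))/2 ≤ m(h/2)`; sharpens the tree's corner bound `ψ(β,h) − ψ(β,0) ≤ β m(β,h) h`).
[cite: FriedliVelenik2017, Prop. 3.29 and Thm. 3.43; GriffithsHurstSherman1970] -/
theorem pressure_sub_pressure_zero_le_midpoint (hd : 1 ≤ d) {β h : ℝ} (hβ : 0 ≤ β) (hh : 0 ≤ h) :
    pressure d β h - pressure d β 0 ≤ β * h * magnetizationInField d β (h / 2) := by
  rcases hh.eq_or_lt with rfl | hpos
  · simp
  rw [← integral_mul_magnetizationInField_eq hd hβ le_rfl hh]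
  have hint := intervalIntegrable_magnetizationInField (d := d) hβ le_rfl hh
  -- the reflected integral equals the original one
  have hrefl : ∫ t in (0 : ℝ)..h, β * magnetizationInField d β (h - t) = ∫ t in (0 : ℝ)..h, β * magnetizationInField d β t := by
    have := intervalIntegral.integral_comp_sub_left (fun t => β * magnetizationInField d β t) h (a := 0) (b := h)
    rw [this, sub_self, sub_zero]
  have hint' : IntervalIntegrable (fun t => β * magnetizationInField d β (h - t)) volume 0 h := by
    have := (hint.const_mul β).comp_sub_left h
    rw [sub_self, sub_zero] at this
    exact this.symm
  -- `2 ∫ βm = ∫ β(m(t) + m(h−t)) ≤ ∫ 2β m(h/2) = 2βh m(h/2)`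
  have hsum : 2 * ∫ t in (0 : ℝ)..h, β * magnetizationInField d β t =
      ∫ t in (0 : ℝ)..h, (β * magnetizationInField d β t + β * magnetizationInField d β (h - t)) := by
    rw [intervalIntegral.integral_add (hint.const_mul β) hint', hrefl]; ring
  have hle : ∫ t in (0 : ℝ)..h, (β * magnetizationInField d β t + β * magnetizationInField d β (h - t)) ≤
      ∫ _t in (0 : ℝ)..h, 2 * (β * magnetizationInField d β (h / 2)) := by
    refine integral_mono_on hpos.le ((hint.const_mul β).add hint') (Continuous.intervalIntegrable (by fun_prop) _ _) ?_
    intro t ht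
    have := magnetizationInField_add_le_two_mul_midpoint (d := d) (h := h) hβ ht.1 ht.2
    nlinarith
  rw [intervalIntegral.integral_const, smul_eq_mul, sub_zero] at hle
  linarith

/-- **The average magnetisation over `[0,h]` is squeezed between the trapezoid and the midpoint values**: for `d ≥ 1`,
`β > 0`, `h > 0`, `(m*(β) + m(β,h))/2 ≤ (ψ(β,h) − ψ(β,0))/(βh) ≤ m(β,h/2)`. [cite: FriedliVelenik2017, Prop. 3.29 and Thm. 3.43; GriffithsHurstSherman1970] -/
theorem average_magnetization_mem_Icc (hd : 1 ≤ d) {β h : ℝ} (hβ : 0 < β) (hh : 0 < h) :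
    (pressure d β h - pressure d β 0) / (β * h) ∈
      Icc ((spontaneousMagnetization d β + magnetizationInField d β h) / 2) (magnetizationInField d β (h / 2)) := by
  have hβh : 0 < β * h := mul_pos hβ hh
  have h1 := trapezoid_le_pressure_sub_pressure_zero hd hβ.le hh.le
  have h2 := pressure_sub_pressure_zero_le_midpoint hd hβ.le hh.le
  constructor
  · rw [le_div_iff₀ hβh]; linarith
  · rw [div_le_iff₀ hβh]; linarith

/-- **Symmetric form in `|h|`**: for `d ≥ 1`, `β ≥ 0` and every real `h`,
`β|h| (m*(β) + m(β,|h|))/2 ≤ ψ(β,h) − ψ(β,0) ≤ β|h| m(β,|h|/2)` (`ψ(β,−h) = ψ(β,h)`). [cite: FriedliVelenik2017, §3.7.1, Prop. 3.29 and Thm. 3.43] -/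
theorem pressure_sub_pressure_zero_mem_Icc_abs (hd : 1 ≤ d) {β : ℝ} (hβ : 0 ≤ β) (h : ℝ) :
    pressure d β h - pressure d β 0 ∈
      Icc (β * |h| * (spontaneousMagnetization d β + magnetizationInField d β |h|) / 2)
        (β * |h| * magnetizationInField d β (|h| / 2)) := by
  have e : pressure d β h = pressure d β |h| := by
    rcases le_or_gt 0 h with hh | hh
    · rw [abs_of_nonneg hh]
    · rw [abs_of_neg hh, pressure_neg_field]
  rw [e]
  exact ⟨trapezoid_le_pressure_sub_pressure_zero hd hβ (abs_nonneg h),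
    pressure_sub_pressure_zero_le_midpoint hd hβ (abs_nonneg h)⟩

/-- **The trapezoid bound between two positive fields**: for `d ≥ 1`, `β ≥ 0`, `0 ≤ a ≤ b`,
`β (b − a) (m(β,a) + m(β,b))/2 ≤ ψ(β,b) − ψ(β,a)` (concavity chord on `[a,b]`). [cite: FriedliVelenik2017, Thm. 3.43; GriffithsHurstSherman1970] -/
theorem trapezoid_le_pressure_sub_pressure (hd : 1 ≤ d) {β a b : ℝ} (hβ : 0 ≤ β) (ha : 0 ≤ a) (hab : a ≤ b) :
    β * (b - a) * (magnetizationInField d β a + magnetizationInField d β b) / 2 ≤ pressure d β b - pressure d β a := by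
  rcases hab.eq_or_lt with rfl | hlt
  · simp
  rw [← integral_mul_magnetizationInField_eq hd hβ ha hab]
  -- the chord on `[a,b]`
  have hchordpt : ∀ t ∈ Icc a b, ((b - t) * magnetizationInField d β a + (t - a) * magnetizationInField d β b) / (b - a) ≤
      magnetizationInField d β t := by
    intro t ht
    have hba : 0 < b - a := sub_pos.2 hlt
    have hconc := (concaveOn_magnetizationInField (d := d) hβ).2 (mem_Ici.2 ha) (mem_Ici.2 (ha.trans hab))
      (show 0 ≤ (b - t) / (b - a) from div_nonneg (by linarith [ht.2]) hba.le)
      (show 0 ≤ (t - a) / (b - a) from div_nonneg (by linarith [ht.1]) hba.le)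
      (show (b - t) / (b - a) + (t - a) / (b - a) = 1 by field_simp; ring)
    have hpt : ((b - t) / (b - a)) • a + ((t - a) / (b - a)) • b = t := by
      simp only [smul_eq_mul]; field_simp; ring
    rw [hpt] at hconc
    simp only [smul_eq_mul] at hconc
    calc ((b - t) * magnetizationInField d β a + (t - a) * magnetizationInField d β b) / (b - a)
        = (b - t) / (b - a) * magnetizationInField d β a + (t - a) / (b - a) * magnetizationInField d β b := by
          field_simp
      _ ≤ magnetizationInField d β t := hconc
  have hchord : ∫ t in a..b, β * (((b - t) * magnetizationInField d β a + (t - a) * magnetizationInField d β b) / (b - a)) =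
      β * (b - a) * (magnetizationInField d β a + magnetizationInField d β b) / 2 := by
    have hba : b - a ≠ 0 := (sub_pos.2 hlt).ne'
    have e : (fun t : ℝ => β * (((b - t) * magnetizationInField d β a + (t - a) * magnetizationInField d β b) / (b - a))) =
        fun t : ℝ => (β * (magnetizationInField d β b - magnetizationInField d β a) / (b - a)) * t +
          β * (b * magnetizationInField d β a - a * magnetizationInField d β b) / (b - a) := by
      funext t; field_simp; ring
    rw [e, intervalIntegral.integral_add ((continuous_const_mul _).intervalIntegrable _ _)
      (continuous_const.intervalIntegrable _ _), intervalIntegral.integral_const_mul, integral_id,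
      intervalIntegral.integral_const]
    simp only [smul_eq_mul]
    field_simp
    ring
  rw [← hchord]
  refine integral_mono_on hab ?_ ((intervalIntegrable_magnetizationInField (d := d) hβ ha (ha.trans hab)).const_mul β) ?_
  · exact (Continuous.intervalIntegrable (by fun_prop) _ _)
  · intro t ht
    exact mul_le_mul_of_nonneg_left (hchordpt t ht) hβ

end IsingPressure

end Summit.CriticalPhenomena.PercolationContinuityZ3.Theorems.FK

end
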